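import Literature.AlgebraicGeometry.Resolution.PointBlowupSinghSharp
import Literature.AlgebraicGeometry.Resolution.NormalSurfaceFirstBlowupMono
import HarnessLib

/-!
# `H^N_{X'}(x') ≤ H^N_X(π x')` at EVERY point of the blow-up of a closed point, for EVERY `N`,
# over a field (CJS 2020, Thm. 3.10 (1) in Singh's sharp form: the hypothesis `hmono` of the
# termination theorem, now also for `N = dim X`)

Topic: `Literature/AlgebraicGeometry/Resolution`. Cossart–Jannsen–Saito, LNM 2270, Thm. 3.10 (1)
("`H_{X'}(x') ≤ H_X(x)`", used at all points of `X' = Bl_x(X)` as hypothesis `hmono` of Thm. 6.17,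
`Scheme.no_infinite_hsFun_tower`). `PointBlowupHsFunMono.lean` assembles this inequality for the
blow-up of a closed point `x` of an integral scheme locally of finite type over a field for
`N > ψ_X(x)` — the Bennett–Hironaka form at the closed points of the fibre costs one summation
index. With Singh's sharp form at the closed points of the fibre (`PointBlowupSinghSharp.lean`:
`H^N_{X'}(x') ≤ H^N_X(x)` for ALL `N` when `𝒪_{X,x}` contains a field — every scheme over a
field) the same assembly gives the inequality for EVERY `N`, in particular for the choice
`N = dim X` of the Hilbert–Samuel layer for normal surfaces (`HilbertSamuelIsolatedSingularities.lean`,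
`N = 2`):

* `IsBlowup.hsFun_le_of_isClosed_point_centre_of_ringHom_field'` — abstract assembly (off the
  fibre: local isomorphism; closed points of the fibre: Singh; non-closed points of the fibre:
  closed specialisation without decrease of `H^N`);
* `IsBlowup.hsFun_le_of_isClosed_point_centre_of_isQuasiExcellent_of_ringHom_field` —
  quasi-excellent `X`, `𝒪_{X,x}` universally catenary and containing a field;
* `IsBlowup.hsFun_le_of_isClosed_point_centre_over_field` — **`H^N_{X'}(x') ≤ H^N_X(π x')` for all
  `x'` and all `N`**, blow-up of a closed point of an integral scheme locally of finite type over a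
  field; `IsBlowup.hsFun_le_of_finite_closedPoints_centre_over_field` — the same for a finite set
  of closed points as centre; `IsBlowup.cor_3_12_of_finite_closedPoints_centre_over_field` —
  CJS Cor. 3.12 for it;
* `hmono_blowup_hsMaxLocus_of_normal_surface_of_two_le`, `cor_3_12_…_of_two_le`,
  `NormalSurface.firstBlowup_hmono_two` — the first blow-up `Bℓ_{X_max}(X) → X` of the CJS strategy
  for a normal surface does not increase `H^N` for every `N ≥ 2` (previously `N ≥ 3`), so the
  `N = 2` first-blow-up data `NormalSurface.firstBlowup` of `HilbertSamuelIsolatedSingularities.lean`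
  come with `hmono` and Cor. 3.12.

No definitions and no named facts are introduced.

## Sources

* V. Cossart, U. Jannsen, S. Saito, LNM 2270 (2020), Thm. 3.10 (1) (p. 43–44), Cor. 3.12,
  Rem. 6.29, Thm. 6.17. [CossartJannsenSaito2020]
* M. Herrmann, S. Ikeda, U. Orbanz, *Equimultiplicity and Blowing up* (1988), Thm. (29.1).
  [HerrmannIkedaOrbanz1988]
-/

noncomputable section

open CategoryTheory IsLocalRing Literature.RingTheory.HilbertSamuel
open TopologicalSpace AlgebraicGeometry.Scheme.IdealSheafData

namespace Literature.AlgebraicGeometry.Resolution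

universe u v

open _root_.AlgebraicGeometry

variable {X X' : Scheme.{u}} {π : X' ⟶ X} {x : X}

/-! ## Assembly for every `N` -/

/-- **CJS Thm. 3.10 (1) for the blow-up of a closed point, at every point of `X'` and for every
`N` — abstract assembly in equal characteristic.** Let `X` be integral and locally Noetherian,
`x ∈ X` a closed point with `𝒪_{X,x}` universally catenary and containing a field `K₀`,
`I({x}) ≠ 0`, `π : X' → X` a blow-up of `x`. Assume: (`hsp`) every point of the fibre specialises,
without decrease of `H^N_{X'}`, to a closed point; (`hfin`) the closed points of `X'` over `x` have
residue field finite over `k(x)`. Then `H^N_{X'}(x') ≤ H^N_X(π x')` for every `x' ∈ X'` (off the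
fibre an equality; on the fibre `H^N_{X'}(x') ≤ H^N_{X'}(y') ≤ H^N_X(x)` for a closed
specialisation `y'`, by Singh's inequality `IsBlowup.hsFun_le_of_finite_residueFieldMap_of_ringHom_field`).
[cite: CossartJannsenSaito2020, Thm. 3.10 (1) (p. 43–44)] [cite: HerrmannIkedaOrbanz1988, Thm. (29.1)] -/
theorem IsBlowup.hsFun_le_of_isClosed_point_centre_of_ringHom_field' [IsIntegral X]
    [IsLocallyNoetherian X] [IsLocallyNoetherian X'] (hx : IsClosed ({x} : Set X))
    (hπ : IsBlowup π (vanishingIdeal ⟨{x}, hx⟩)) (hJ0 : vanishingIdeal ⟨{x}, hx⟩ ≠ ⊥)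
    (hUC : IsUniversallyCatenaryRing (X.presheaf.stalk x)) {K₀ : Type v} [Field K₀]
    (κ₀ : K₀ →+* X.presheaf.stalk x) (N : ℕ)
    (hsp : ∀ a : X', π.base a = x →
      ∃ b : X', IsClosed ({b} : Set X') ∧ a ⤳ b ∧ Scheme.hsFun X' N a ≤ Scheme.hsFun X' N b)
    (hfin : ∀ y' : X', IsClosed ({y'} : Set X') → π.base y' = x →
      (ResidueField.map (π.stalkMap y').hom).Finite)
    (x' : X') : Scheme.hsFun X' N x' ≤ Scheme.hsFun X N (π.base x') := by
  by_cases hx' : π.base x' = x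
  · -- on the fibre: specialise to a closed point of the fibre
    obtain ⟨y', hy'cl, hxy', hle⟩ := hsp x' hx'
    have hπy' : π.base y' = x := by
      have hsp' : π.base x' ⤳ π.base y' := hxy'.map π.base.hom.continuous
      rw [hx'] at hsp'
      have hmem : π.base y' ∈ closure ({x} : Set X) := hsp'.mem_closure
      rw [hx.closure_eq] at hmem
      exact hmem
    have hJ : stalkIdeal (vanishingIdeal ⟨{x}, hx⟩) (π.base y') =
        maximalIdeal (X.presheaf.stalk (π.base y')) := by
      have hcl' : (⟨{x}, hx⟩ : Closeds X) = ⟨closure {x}, isClosed_closure⟩ :=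
        Closeds.ext hx.closure_eq.symm
      rw [hπy', hcl']
      exact stalkIdeal_vanishingIdeal_closure_self x
    have hUC' : IsUniversallyCatenaryRing (X.presheaf.stalk (π.base y')) := by rw [hπy']; exact hUC
    have κ₀' : K₀ →+* X.presheaf.stalk (π.base y') := by rw [hπy']; exact κ₀
    calc Scheme.hsFun X' N x' ≤ Scheme.hsFun X' N y' := hle
      _ ≤ Scheme.hsFun X N (π.base y') :=
          hπ.hsFun_le_of_finite_residueFieldMap_of_ringHom_field hJ0 y' hUC' hJ κ₀'
            (hfin y' hy'cl hπy') N
      _ = Scheme.hsFun X N (π.base x') := by rw [hπy', hx']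
  · exact (hπ.hsFun_eq_of_ne hx hx' N).le

/-- **CJS Thm. 3.10 (1) for the blow-up of a closed point of a quasi-excellent scheme in equal
characteristic, at every point of `X'` and for every `N`.** Let `X` be integral, locally Noetherian
and quasi-excellent, `x ∈ X` a closed point with `𝒪_{X,x}` universally catenary (e.g. `X`
excellent) and containing a field, `π : X' → X` a blow-up of `x`. Then
`H^N_{X'}(x') ≤ H^N_X(π x')` for every `x' ∈ X'` and every `N`.
[cite: CossartJannsenSaito2020, Thm. 3.10 (1) (p. 43–44)] [cite: HerrmannIkedaOrbanz1988, Thm. (29.1)] -/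
theorem IsBlowup.hsFun_le_of_isClosed_point_centre_of_isQuasiExcellent_of_ringHom_field
    [IsIntegral X] [IsLocallyNoetherian X] (hqe : Scheme.IsQuasiExcellent X)
    (hx : IsClosed ({x} : Set X)) (hπ : IsBlowup π (vanishingIdeal ⟨{x}, hx⟩))
    (hUC : IsUniversallyCatenaryRing (X.presheaf.stalk x)) {K₀ : Type v} [Field K₀]
    (κ₀ : K₀ →+* X.presheaf.stalk x) (N : ℕ) (x' : X') :
    Scheme.hsFun X' N x' ≤ Scheme.hsFun X N (π.base x') := by
  -- if `I({x}) = 0` (i.e. `X = {x}`) the blow-up is empty and there is nothing to prove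
  by_cases hJ0 : vanishingIdeal ⟨{x}, hx⟩ = ⊥
  · rw [hJ0] at hπ
    exact ((IsBlowup.isEmpty_of_bot hπ).false x').elim
  haveI : IsProper π := hπ.isProper
  haveI : IsLocallyNoetherian X' := LocallyOfFiniteType.isLocallyNoetherian π
  -- the fibre over the closed point `x` is closed and Jacobson
  have hF : IsClosed (π.base ⁻¹' ({x} : Set X)) := hx.preimage π.base.hom.continuous
  haveI : JacobsonSpace (π.base ⁻¹' ({x} : Set X)) :=
    .of_isClosedEmbedding (π.fiberHomeo x).symm.isClosedEmbedding
  refine hπ.hsFun_le_of_isClosed_point_centre_of_ringHom_field' hx hJ0 hUC κ₀ N (fun a ha => ?_)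
    (fun y' hy' _ => finite_residueFieldMap_of_isClosed π hy') x'
  refine Scheme.exists_isClosed_specializes_hsFun_le N a hF ha
    (isOpen_regularLocus_subscheme_of_locallyOfFiniteType π hqe _) (fun b _ hab => ?_)
  -- `b` lies in the (closed) fibre over `x`, so `𝒪_{X,π b} = 𝒪_{X,x}` is universally catenary
  have hπb : π.base b = x := by
    have hsp' : π.base a ⤳ π.base b := hab.map π.base.hom.continuous
    rw [show π.base a = x from ha] at hsp'
    have hmem : π.base b ∈ closure ({x} : Set X) := hsp'.mem_closure
    rw [hx.closure_eq] at hmem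
    exact hmem
  have hUCb : IsUniversallyCatenaryRing (X.presheaf.stalk (π.base b)) := by rw [hπb]; exact hUC
  exact isCatenaryRing_stalk_of_locallyOfFiniteType π b hUCb

/-- **CJS Thm. 3.10 (1) for the blow-up of a closed point of a scheme locally of finite type over
a field, at every point of `X'` and for EVERY `N` — unconditionally.** Let `k` be a field, `X` an
integral scheme locally of finite type over `k`, `x ∈ X` a closed point, `π : X' → X` a blow-up of
`x` (`IsBlowup π I({x})`). Then `H^N_{X'}(x') ≤ H^N_X(π x')` for every `x' ∈ X'` and every `N` —
the hypothesis `hmono` of `Scheme.no_infinite_hsFun_tower` for this blow-up, for any admissible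
`N ≥ dim X` (compare `IsBlowup.hsFun_le_of_isClosed_point_centre_of_locallyOfFiniteType`,
`N > ψ_X(x)`). [cite: CossartJannsenSaito2020, Thm. 3.10 (1) (p. 43–44)]
[cite: HerrmannIkedaOrbanz1988, Thm. (29.1)] -/
theorem IsBlowup.hsFun_le_of_isClosed_point_centre_over_field {k : Type u} [Field k]
    [IsIntegral X] (f : X ⟶ Spec (.of k)) [LocallyOfFiniteType f]
    (hx : IsClosed ({x} : Set X)) (hπ : IsBlowup π (vanishingIdeal ⟨{x}, hx⟩)) (N : ℕ)
    (x' : X') : Scheme.hsFun X' N x' ≤ Scheme.hsFun X N (π.base x') := by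
  haveI : IsLocallyNoetherian X := LocallyOfFiniteType.isLocallyNoetherian f
  have hexc : Scheme.IsExcellent X := Scheme.isExcellent_of_locallyOfFiniteType Stacks07QW_field_holds f
  -- `k → Γ(X, 𝒪_X) → 𝒪_{X,x}`: the local ring at `x` contains the field `k`
  exact hπ.hsFun_le_of_isClosed_point_centre_of_isQuasiExcellent_of_ringHom_field
    hexc.isQuasiExcellent hx (hexc.isUniversallyCatenaryRing_stalk x)
    ((X.presheaf.germ ⊤ x trivial).hom.comp (f.appTop.hom.comp (Scheme.ΓSpecIso (.of k)).inv.hom))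
    N x'

/-- **CJS Thm. 3.10 (1) for the blow-up of a finite set of closed points of a scheme locally of
finite type over a field, at every point of `X'` and for EVERY `N` — unconditionally** (e.g. the
first blow-up `Bℓ_{X_max}(X)` of the CJS strategy for a normal surface, Rem. 6.29, with `N = 2`).
Over the open `U = X ∖ (D ∖ {x})`, `x = π x'`, the blow-up restricts to the blow-up of `U` at the
closed point `x`, where `IsBlowup.hsFun_le_of_isClosed_point_centre_over_field` applies; `H^N` is
local. [cite: CossartJannsenSaito2020, Thm. 3.10 (1) (p. 44), Rem. 6.29] -/
theorem IsBlowup.hsFun_le_of_finite_closedPoints_centre_over_field {k : Type u}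
    [Field k] [IsIntegral X] (f : X ⟶ Spec (.of k)) [LocallyOfFiniteType f] {D : Set X}
    (hDfin : D.Finite) (hDcl : ∀ y ∈ D, IsClosed ({y} : Set X)) (hD : IsClosed D)
    (hπ : IsBlowup π (vanishingIdeal ⟨D, hD⟩)) (N : ℕ) (x' : X') :
    Scheme.hsFun X' N x' ≤ Scheme.hsFun X N (π.base x') := by
  haveI : IsLocallyNoetherian X := LocallyOfFiniteType.isLocallyNoetherian f
  haveI : IsProper π := hπ.isProper
  haveI : IsLocallyNoetherian X' := LocallyOfFiniteType.isLocallyNoetherian π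
  by_cases hx'D : π.base x' ∈ D
  swap
  · exact (hπ.hsFun_eq_of_not_mem (Z := ⟨D, hD⟩) hx'D N).le
  -- `U = X ∖ (D ∖ {x})`, `x = π x'`
  have hcl : IsClosed (D \ {π.base x'}) :=
    isClosed_of_finite_of_forall_isClosed_singleton (hDfin.subset Set.sdiff_subset)
      fun y hy => hDcl y hy.1
  let U : X.Opens := ⟨(D \ {π.base x'})ᶜ, hcl.isOpen_compl⟩
  have hxU : π.base x' ∈ U := fun h => h.2 rfl
  have hx'U : x' ∈ π ⁻¹ᵁ U := hxU
  -- the closed point `xU` of `U` over `x`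
  obtain ⟨xU, hxUeq⟩ : ∃ xU : (U : Scheme.{u}), U.ι.base xU = π.base x' := ⟨⟨π.base x', hxU⟩, rfl⟩
  have hinj : Function.Injective U.ι.base := U.ι.isOpenEmbedding.injective
  have h1 : ({xU} : Set (U : Scheme.{u})) = U.ι.base ⁻¹' {π.base x'} := by
    ext u
    simp only [Set.mem_singleton_iff, Set.mem_preimage]
    rw [← hxUeq]
    exact ⟨fun h => h ▸ rfl, fun h => hinj h⟩
  have hxUcl : IsClosed ({xU} : Set (U : Scheme.{u})) := by
    rw [h1]
    exact (hDcl _ hx'D).preimage U.ι.base.hom.continuous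
  -- `U ∩ D = {x}`
  have hpre : (⟨D, hD⟩ : Closeds X).preimage U.ι.continuous = ⟨{xU}, hxUcl⟩ := by
    ext u
    change U.ι.base u ∈ D ↔ u ∈ ({xU} : Set (U : Scheme.{u}))
    rw [h1, Set.mem_preimage, Set.mem_singleton_iff]
    refine ⟨fun hu => ?_, fun hu => hu ▸ hx'D⟩
    have huU : U.ι.base u ∈ (U : Set X) := by
      rw [← Scheme.Opens.range_ι]
      exact ⟨u, rfl⟩
    by_contra hne
    exact huU ⟨hu, hne⟩
  -- the restricted blow-up is the blow-up of `U` at `xU`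
  have hπU : IsBlowup (π ∣_ U) (vanishingIdeal ⟨{xU}, hxUcl⟩) := by
    have h := hπ.restrict U
    rwa [comap_vanishingIdeal_of_isOpenImmersion, hpre] at h
  haveI : Nonempty (U : Scheme.{u}) := ⟨xU⟩
  haveI : IsIntegral (U : Scheme.{u}) := isIntegral_of_isOpenImmersion U.ι
  have key := hπU.hsFun_le_of_isClosed_point_centre_over_field (U.ι ≫ f) hxUcl N ⟨x', hx'U⟩
  rw [Scheme.hsFun_opens (π ⁻¹ᵁ U) N ⟨x', hx'U⟩, Scheme.hsFun_opens U N] at key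
  have h2 : U.ι.base ((π ∣_ U).base ⟨x', hx'U⟩) = π.base x' :=
    morphismRestrict_base_coe π U ⟨x', hx'U⟩
  rw [h2] at key
  exact key

/-- **CJS Cor. 3.12 for the blow-up of a finite set of closed points of a scheme locally of finite
type over a field, for every `N`:** a maximal value of `Σ_X` surviving in `Σ_{X'}` is maximal in
`Σ_{X'}`, `X'(ν) ⊆ π⁻¹(X(ν))` for `ν ∈ Σ_X^max`, and `π⁻¹(X(ν)) ⊆ ⋃_{μ ≤ ν} X'(μ)`.
[cite: CossartJannsenSaito2020, Cor. 3.12, Rem. 6.29] -/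
theorem IsBlowup.cor_3_12_of_finite_closedPoints_centre_over_field {k : Type u} [Field k]
    [IsIntegral X] (f : X ⟶ Spec (.of k)) [LocallyOfFiniteType f] {D : Set X} (hDfin : D.Finite)
    (hDcl : ∀ y ∈ D, IsClosed ({y} : Set X)) (hD : IsClosed D)
    (hπ : IsBlowup π (vanishingIdeal ⟨D, hD⟩)) (N : ℕ) :
    (∀ ν, Maximal (· ∈ Scheme.hsValues X N) ν → ν ∈ Scheme.hsValues X' N →
        Maximal (· ∈ Scheme.hsValues X' N) ν) ∧
      (∀ ν, Maximal (· ∈ Scheme.hsValues X N) ν →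
        Scheme.hsStratum X' N ν ⊆ π.base ⁻¹' Scheme.hsStratum X N ν) ∧
      (∀ ν : ℕ → ℕ, π.base ⁻¹' Scheme.hsStratum X N ν ⊆
        ⋃ μ ∈ {μ : ℕ → ℕ | μ ≤ ν}, Scheme.hsStratum X' N μ) := by
  haveI : IsLocallyNoetherian X := LocallyOfFiniteType.isLocallyNoetherian f
  haveI : IsProper π := hπ.isProper
  haveI : IsLocallyNoetherian X' := LocallyOfFiniteType.isLocallyNoetherian π
  have hmono := hπ.hsFun_le_of_finite_closedPoints_centre_over_field f hDfin hDcl hD N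
  exact ⟨fun _ hν hν' => Scheme.maximal_hsValues_of_hmono N π.base hmono hν hν',
    fun _ hν => Scheme.hsStratum_subset_preimage_of_hmono N π.base hmono hν,
    fun ν => Scheme.preimage_hsStratum_subset_of_hmono N π.base hmono ν⟩

/-! ## The first blow-up of a normal surface, `N ≥ 2` -/

section NormalSurfaces

variable {k : Type u} [Field k] [IsIntegral X] [_root_.AlgebraicGeometry.IsNoetherian X]
  (f : X ⟶ Spec (.of k)) [LocallyOfFiniteType f]
  (hN : ∀ x : X, IsIntegrallyClosed (X.presheaf.stalk x))
  (hdim : topologicalKrullDim X ≤ 2) {N : ℕ} (hN2 : 2 ≤ N)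

include f hN hdim hN2 in
/-- **CJS Thm. 3.10 (1) for the first blow-up of a normal surface, every `N ≥ 2`:
`H^N_{X₁}(x') ≤ H^N_X(π x')` at every point `x'` of `X₁ = Bℓ_{X_max}(X)`**, for `X` a non-regular
normal surface of finite type over a field (`X_max` is a finite set of closed points; Singh's sharp
form removes the restriction `N ≥ 3` of `hmono_blowup_hsMaxLocus_of_normal_surface`). This is the
hypothesis `hmono` of `Scheme.no_infinite_hsFun_tower` for the first step of the CJS strategy in
dimension two with the standard choice `N = dim X = 2`.
[cite: CossartJannsenSaito2020, Thm. 3.10 (1), Rem. 6.29] -/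
theorem hmono_blowup_hsMaxLocus_of_normal_surface_of_two_le (hX : ¬Scheme.IsRegular X)
    {Z : Closeds X} (hZ : (Z : Set X) = Scheme.hsMaxLocus X N) (x' : blowup (vanishingIdeal Z)) :
    Scheme.hsFun (blowup (vanishingIdeal Z)) N x' ≤
      Scheme.hsFun X N ((blowup.π (vanishingIdeal Z)).base x') := by
  obtain ⟨hfin, -, -, hclm⟩ := hsMaxLocus_of_normal_surface' f hN hdim hN2 hX
  exact (blowup.isBlowup (vanishingIdeal Z)).hsFun_le_of_finite_closedPoints_centre_over_field
    f (hZ ▸ hfin) (fun y hy => hclm y (hZ ▸ hy)) Z.isClosed N x'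

include f hN hdim hN2 in
/-- **CJS Cor. 3.12 for the first blow-up `π : X₁ = Bℓ_{X_max}(X) → X` of a normal surface**, every
`N ≥ 2`: a maximal value of `Σ_X` surviving in `Σ_{X₁}` is maximal in `Σ_{X₁}`;
`X₁(ν) ⊆ π⁻¹(X(ν))` for `ν ∈ Σ_X^max`; `π⁻¹(X(ν)) ⊆ ⋃_{μ ≤ ν} X₁(μ)`.
[cite: CossartJannsenSaito2020, Cor. 3.12, Rem. 6.29] -/
theorem cor_3_12_blowup_hsMaxLocus_of_normal_surface_of_two_le (hX : ¬Scheme.IsRegular X)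
    {Z : Closeds X} (hZ : (Z : Set X) = Scheme.hsMaxLocus X N) :
    (∀ ν, Maximal (· ∈ Scheme.hsValues X N) ν →
        ν ∈ Scheme.hsValues (blowup (vanishingIdeal Z)) N →
          Maximal (· ∈ Scheme.hsValues (blowup (vanishingIdeal Z)) N) ν) ∧
      (∀ ν, Maximal (· ∈ Scheme.hsValues X N) ν →
        Scheme.hsStratum (blowup (vanishingIdeal Z)) N ν ⊆
          (blowup.π (vanishingIdeal Z)).base ⁻¹' Scheme.hsStratum X N ν) ∧
      (∀ ν : ℕ → ℕ, (blowup.π (vanishingIdeal Z)).base ⁻¹' Scheme.hsStratum X N ν ⊆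
        ⋃ μ ∈ {μ : ℕ → ℕ | μ ≤ ν}, Scheme.hsStratum (blowup (vanishingIdeal Z)) N μ) := by
  have hmono := hmono_blowup_hsMaxLocus_of_normal_surface_of_two_le f hN hdim hN2 hX hZ
  exact ⟨fun _ hν hν' => Scheme.maximal_hsValues_of_hmono N _ hmono hν hν',
    fun _ hν => Scheme.hsStratum_subset_preimage_of_hmono N _ hmono hν,
    fun ν => Scheme.preimage_hsStratum_subset_of_hmono N _ hmono ν⟩

end NormalSurfaces

/-! ## Bundled normal surfaces, `N = 2` -/

namespace NormalSurface

variable {k : Type u} [Field k] (S : NormalSurface k)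

/-- **The first blow-up `Bℓ_{X_max}(X) → X` of a non-regular bundled normal surface does not
increase `H^2`** (`N = 2 = dim X`, the indexing of `NormalSurface.firstBlowup`) and satisfies
Cor. 3.12. [cite: CossartJannsenSaito2020, Thm. 3.10 (1), Cor. 3.12, Rem. 6.29] -/
theorem firstBlowup_hmono_two (hX : ¬Scheme.IsRegular S.X) {Z : Closeds S.X}
    (hZ : (Z : Set S.X) = Scheme.hsMaxLocus S.X 2) :
    (∀ x' : blowup (vanishingIdeal Z), Scheme.hsFun (blowup (vanishingIdeal Z)) 2 x' ≤
        Scheme.hsFun S.X 2 ((blowup.π (vanishingIdeal Z)).base x')) ∧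
      (∀ ν, Maximal (· ∈ Scheme.hsValues S.X 2) ν →
        ν ∈ Scheme.hsValues (blowup (vanishingIdeal Z)) 2 →
          Maximal (· ∈ Scheme.hsValues (blowup (vanishingIdeal Z)) 2) ν) ∧
      (∀ ν, Maximal (· ∈ Scheme.hsValues S.X 2) ν →
        Scheme.hsStratum (blowup (vanishingIdeal Z)) 2 ν ⊆
          (blowup.π (vanishingIdeal Z)).base ⁻¹' Scheme.hsStratum S.X 2 ν) := by
  haveI := S.isNoetherian_X
  have h := cor_3_12_blowup_hsMaxLocus_of_normal_surface_of_two_le S.hom S.normal S.dim_eq.le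
    le_rfl hX hZ
  exact ⟨hmono_blowup_hsMaxLocus_of_normal_surface_of_two_le S.hom S.normal S.dim_eq.le le_rfl hX hZ,
    h.1, h.2.1⟩

/-- **Every maximal value `ν ∈ Σ_X^max` (`N = 2`) that survives the first blow-up is again
maximal on `X₁ = Bℓ_{X_max}(X)`, and the points of `X₁(ν)` lie over `X(ν) ⊆ X_max`** — the
dichotomy of Cor. 3.12 driving the `Σ^max`-elimination bookkeeping (Def. 6.15 (ME2) asks that no
such `ν` survive after finitely many steps). [cite: CossartJannsenSaito2020, Cor. 3.12, Def. 6.15] -/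
theorem firstBlowup_mem_hsMaxLocus_of_hsFun_eq (hX : ¬Scheme.IsRegular S.X) {Z : Closeds S.X}
    (hZ : (Z : Set S.X) = Scheme.hsMaxLocus S.X 2) {ν : ℕ → ℕ}
    (hν : Maximal (· ∈ Scheme.hsValues S.X 2) ν) {x' : blowup (vanishingIdeal Z)}
    (hx' : Scheme.hsFun (blowup (vanishingIdeal Z)) 2 x' = ν) :
    x' ∈ Scheme.hsMaxLocus (blowup (vanishingIdeal Z)) 2 ∧
      (blowup.π (vanishingIdeal Z)).base x' ∈ Scheme.hsMaxLocus S.X 2 ∧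
        Scheme.hsFun S.X 2 ((blowup.π (vanishingIdeal Z)).base x') = ν := by
  haveI := S.isNoetherian_X
  exact Scheme.mem_hsMaxLocus_and_of_hmono 2 _
    (hmono_blowup_hsMaxLocus_of_normal_surface_of_two_le S.hom S.normal S.dim_eq.le le_rfl hX hZ)
    hν hx'

end NormalSurface

end Literature.AlgebraicGeometry.Resolution

end
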